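import Literature.RingTheory.TightClosure.FrobeniusClosedPrincipal
import Mathlib.RingTheory.Regular.RegularSequence
import Mathlib.RingTheory.LocalProperties.Basic
import Mathlib.RingTheory.Localization.AtPrime.Basic
import Mathlib.RingTheory.Localization.FractionRing
import Mathlib.RingTheory.Adjoin.FG
import Mathlib.Algebra.CharP.Algebra
import Mathlib.Data.Fin.SuccPred
import HarnessLib

/-!
# No-go for parameter-ideal centres (crux `FInjectiveMacaulayfication`, route `FrobeniusLadder`)

Support (negative / design-constraint) lemmas for crux stmt-ResolutionOfSingularities-15315
(`Summit.ResolutionOfSingularities.ResolutionOfSingularities.Theses.FrobeniusLadder.FInjectiveMacaulayfication`)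
and for the open stub `stub_fInjectivize` of line `Sketch` ("F-injectivise a scheme whose stalks are
Cohen–Macaulay domains by a proper birational CM-preserving modification"), filed by the line lead.

**The theorem.** Let `R` be a domain, `g₀, …, g_d ∈ R` with `g_d ≠ 0` a non-zerodivisor modulo
`𝔟 = (g₀, …, g_{d-1})` (e.g. `g` a weakly regular sequence — a system of parameters of a Cohen–Macaulay
local ring), `𝔞 = (g₀, …, g_d)`, and let `A = R[g₀/g_d, …, g_{d-1}/g_d] ⊆ Frac R` — the coordinate ring of
the chart `D₊(g_d)` of the blow-up `Bl_𝔞 Spec R = Proj R[𝔞t]`. If at every maximal ideal `M` of `A` the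
principal ideal `g_d · A_M` is Frobenius closed (inline form, exponent base `p`:
`(∃ e, w^(p^e) ∈ span {z^(p^e) | z ∈ (g_d)}) → w ∈ (g_d)`), then `𝔞` is Frobenius closed in `R`
(`frobeniusClosed_of_blowupChart`). Mechanism: `y^q ∈ 𝔞^[q]` gives `(y/1)^q ∈ g_d^q A` because
`z/g_d ∈ A` for `z ∈ 𝔞`; Frobenius-closedness of `(g_d)` at every `A_M` and the local-global principle
give `y ∈ g_d A`, i.e. `y g_dⁿ ∈ g_d 𝔞ⁿ`; and `y g_d^k ∈ 𝔞^(k+1) ⇒ y ∈ 𝔞` because `g_d` is regular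
modulo `𝔟` (`𝔞^(k+1) ⊆ 𝔟 + (g_d^(k+1))`).

**The no-go** (`exists_not_fInjectiveClause_of_blowupChart`): consequently, if `R` is moreover
Noetherian of prime characteristic `p` and `𝔞` is NOT Frobenius closed, some local ring `A_M` (`M`
maximal) — the stalk of `Bl_𝔞 Spec R` at a closed point of the chart `D₊(g_d)` — VIOLATES the crux's
per-stalk clause (domain ∧ every system of parameters weakly regular ∧ every parameter ideal Frobenius
closed): by `Literature…span_singleton_frobeniusClosed_of_fInjective_clause` the clause at a Noetherian
local domain forces all principal ideals to be Frobenius closed. Since a Cohen–Macaulay local ring that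
is not F-injective has a non-Frobenius-closed ideal generated by a system of parameters (Fedder 1983;
Quy–Shimomoto 2017, converse direction Main Thm. A), **Kawasaki's Macaulayfication move transplanted one
rung up — blow up an ideal generated by a system of parameters at a non-F-injective Cohen–Macaulay point
— never yields the model the crux asks for, for any prime `p` and any ring**, as long as the centre is
the offending parameter ideal. This is the general form of the chart witnesses
`stub_parameter_blowup_not_frobenius_closed` (p129192: `E₈⁰`, centre `(x, y)`, height-one failure) and
`Negative.fInjectiveMacaulayfication_parameterBlowupChart_not_frobeniusClosed` (p129572), and it makes
the route header's foreseen split `IsolatedFInjBlowup` ("one blow-up of a Frobenius-standard parameter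
ideal is CM F-injective") untenable whenever that parameter ideal is not already Frobenius closed.

No definition is declared: the chart algebra is written `Algebra.adjoin R {g i / g_d}` inline.
-/

-- single-problem summit: the doubled namespace component `ResolutionOfSingularities` is forced
set_option linter.dupNamespace false

noncomputable section

open IsLocalRing

namespace Summit.ResolutionOfSingularities.ResolutionOfSingularities.Theorems.FInjectiveMacaulayfication

/-! ## §1 Elementary ideal arithmetic around `𝔞 = 𝔟 + (x)` with `x` regular modulo `𝔟` -/

section IdealArith

variable {R : Type*} [CommRing R]

/-- `(𝔟 + (x))ᵐ ⊆ 𝔟 + (xᵐ)`: a product of `m` factors from `𝔟 ∪ (x)` either has a factor in `𝔟` or is a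
multiple of `xᵐ`. [folklore] -/
theorem sup_span_singleton_pow_le (𝔟 : Ideal R) (x : R) (m : ℕ) :
    (𝔟 ⊔ Ideal.span {x}) ^ m ≤ 𝔟 ⊔ Ideal.span {x ^ m} := by
  induction m with
  | zero => simp
  | succ m ih =>
    rw [pow_succ]
    calc (𝔟 ⊔ Ideal.span {x}) ^ m * (𝔟 ⊔ Ideal.span {x})
        ≤ (𝔟 ⊔ Ideal.span {x ^ m}) * (𝔟 ⊔ Ideal.span {x}) := Ideal.mul_mono_left ih
      _ ≤ 𝔟 ⊔ Ideal.span {x ^ (m + 1)} := by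
          rw [Ideal.mul_sup, Ideal.sup_mul, Ideal.sup_mul]
          refine sup_le (sup_le (Ideal.mul_le_right.trans le_sup_left)
            (Ideal.mul_le_left.trans le_sup_left))
            (sup_le (Ideal.mul_le_right.trans le_sup_left) ?_)
          rw [Ideal.span_singleton_mul_span_singleton, ← pow_succ]
          exact le_sup_right

/-- If `x` is a non-zerodivisor modulo `𝔟` then so is every power `xᵐ`. [folklore] -/
theorem mem_of_pow_mul_mem {𝔟 : Ideal R} {x : R} (hx : ∀ u : R, x * u ∈ 𝔟 → u ∈ 𝔟) (m : ℕ)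
    (u : R) (hu : x ^ m * u ∈ 𝔟) : u ∈ 𝔟 := by
  induction m generalizing u with
  | zero => simpa using hu
  | succ m ih =>
    refine ih u (hx _ ?_)
    rw [← mul_assoc, mul_comm x, ← pow_succ]
    exact hu

/-- **`y·x^k ∈ 𝔞^(k+1) ⇒ y ∈ 𝔞`** for `𝔞 = 𝔟 + (x)` with `x` a non-zerodivisor modulo `𝔟` (write
`y x^k = b + c x^(k+1)`, so `x^k (y - c x) ∈ 𝔟` and `y - c x ∈ 𝔟`). [folklore] -/
theorem mem_of_mul_pow_mem_pow {𝔟 : Ideal R} {x : R} (hx : ∀ u : R, x * u ∈ 𝔟 → u ∈ 𝔟)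
    (k : ℕ) (y : R) (hy : y * x ^ k ∈ (𝔟 ⊔ Ideal.span {x}) ^ (k + 1)) :
    y ∈ 𝔟 ⊔ Ideal.span {x} := by
  have hy' := sup_span_singleton_pow_le 𝔟 x (k + 1) hy
  obtain ⟨b, hb, z, hz, hbz⟩ := Submodule.mem_sup.mp hy'
  obtain ⟨c, rfl⟩ := Ideal.mem_span_singleton'.mp hz
  have hmem : x ^ k * (y - c * x) ∈ 𝔟 := by
    have hb' : b = y * x ^ k - c * x ^ (k + 1) := by rw [← hbz]; ring
    have : x ^ k * (y - c * x) = b := by rw [hb']; ring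
    rw [this]; exact hb
  have h := mem_of_pow_mul_mem hx k _ hmem
  have : y = (y - c * x) + c * x := by ring
  rw [this]
  exact Submodule.add_mem_sup h (Ideal.mem_span_singleton'.mpr ⟨c, rfl⟩)

/-- The ideal of a tuple `g : Fin (d+1) → R` is the ideal of its first `d` entries plus the principal
ideal of the last one. [folklore] -/
theorem span_range_eq_sup_span_last {d : ℕ} (g : Fin (d + 1) → R) :
    Ideal.span (Set.range g) =
      Ideal.span (Set.range fun i : Fin d => g i.castSucc) ⊔ Ideal.span {g (Fin.last d)} := by
  apply le_antisymm
  · refine Ideal.span_le.mpr ?_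
    rintro _ ⟨i, rfl⟩
    rcases Fin.eq_castSucc_or_eq_last i with ⟨j, rfl⟩ | rfl
    · exact Ideal.mem_sup_left (Ideal.subset_span ⟨j, rfl⟩)
    · exact Ideal.mem_sup_right (Ideal.subset_span rfl)
  · refine sup_le (Ideal.span_mono ?_) (Ideal.span_mono ?_)
    · rintro _ ⟨j, rfl⟩; exact ⟨j.castSucc, rfl⟩
    · rintro _ rfl; exact ⟨Fin.last d, rfl⟩

/-- From a weakly regular sequence `g₀, …, g_d` (Mathlib `RingTheory.Sequence.IsWeaklyRegular`, the
"depth half" of the crux's clause / the Cohen–Macaulay hypothesis of `stub_fInjectivize`): the last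
element is a non-zerodivisor modulo the first `d`. [folklore] -/
theorem mem_of_last_mul_mem_of_isWeaklyRegular {d : ℕ} (g : Fin (d + 1) → R)
    (h : RingTheory.Sequence.IsWeaklyRegular R (List.ofFn g)) (u : R)
    (hu : g (Fin.last d) * u ∈ Ideal.span (Set.range fun i : Fin d => g i.castSucc)) :
    u ∈ Ideal.span (Set.range fun i : Fin d => g i.castSucc) := by
  rw [List.ofFn_succ', List.concat_eq_append, RingTheory.Sequence.isWeaklyRegular_append_iff,
    RingTheory.Sequence.isWeaklyRegular_singleton_iff] at h
  have hreg := h.2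
  set N : Submodule R R := (Ideal.ofList (List.ofFn fun i : Fin d => g i.castSucc) • ⊤ : Submodule R R)
    with hN
  have hset : {r | r ∈ List.ofFn fun i : Fin d => g i.castSucc} =
      Set.range (fun i : Fin d => g i.castSucc) := by
    ext r
    simp [List.mem_ofFn']
  have hNeq : N = (Ideal.span (Set.range fun i : Fin d => g i.castSucc) : Submodule R R) := by
    simp only [hN, Ideal.smul_eq_mul, Ideal.mul_top]
    dsimp only [Ideal.ofList]
    rw [hset]
  have h0 : (Submodule.Quotient.mk (g (Fin.last d) * u) : R ⧸ N) = 0 := by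
    rw [Submodule.Quotient.mk_eq_zero, hNeq]
    exact hu
  have h1 : g (Fin.last d) • (Submodule.Quotient.mk u : R ⧸ N) = g (Fin.last d) • 0 := by
    rw [smul_zero, ← Submodule.Quotient.mk_smul, smul_eq_mul]
    exact h0
  have h2 := hreg h1
  rw [Submodule.Quotient.mk_eq_zero, hNeq] at h2
  exact h2

end IdealArith

/-! ## §2 The chart algebra `A = R[g₀/g_d, …, g_{d-1}/g_d] ⊆ Frac R` -/

section Chart

variable {R : Type} [CommRing R] [IsDomain R] {d : ℕ} (g : Fin (d + 1) → R)


/-- `z ∈ (g) ⇒ z / g_d ∈ A`. [folklore] -/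
theorem div_last_mem_adjoin {z : R} (hz : z ∈ Ideal.span (Set.range g)) :
    (algebraMap R (FractionRing R)) z / (algebraMap R (FractionRing R)) (g (Fin.last d)) ∈ (Algebra.adjoin R (Set.range fun i : Fin (d + 1) => algebraMap R (FractionRing R) (g i) / algebraMap R (FractionRing R) (g (Fin.last d)))) := by
  refine Submodule.span_induction (p := fun z _ => (algebraMap R (FractionRing R)) z / (algebraMap R (FractionRing R)) (g (Fin.last d)) ∈ (Algebra.adjoin R (Set.range fun i : Fin (d + 1) => algebraMap R (FractionRing R) (g i) / algebraMap R (FractionRing R) (g (Fin.last d))))) ?_ ?_ ?_ ?_ hz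
  · rintro _ ⟨i, rfl⟩
    exact Algebra.subset_adjoin ⟨i, rfl⟩
  · rw [map_zero, zero_div]; exact zero_mem _
  · intro a b _ _ ha hb
    rw [map_add, add_div]; exact add_mem ha hb
  · intro r a _ ha
    rw [smul_eq_mul, map_mul, mul_div_assoc]
    exact mul_mem (Subalgebra.algebraMap_mem _ r) ha

/-- Elements of the chart algebra have the shape `r / g_dⁿ` with `r ∈ (g)ⁿ`. [folklore] -/
theorem exists_mul_pow_eq_of_mem_adjoin {c : (FractionRing R)} (hc : c ∈ (Algebra.adjoin R (Set.range fun i : Fin (d + 1) => algebraMap R (FractionRing R) (g i) / algebraMap R (FractionRing R) (g (Fin.last d))))) :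
    ∃ (n : ℕ) (r : R), r ∈ Ideal.span (Set.range g) ^ n ∧
      c * (algebraMap R (FractionRing R)) (g (Fin.last d)) ^ n = (algebraMap R (FractionRing R)) r := by
  refine Algebra.adjoin_induction (p := fun c _ => ∃ (n : ℕ) (r : R),
      r ∈ Ideal.span (Set.range g) ^ n ∧ c * (algebraMap R (FractionRing R)) (g (Fin.last d)) ^ n = (algebraMap R (FractionRing R)) r) ?_ ?_ ?_ ?_ hc
  · rintro _ ⟨i, rfl⟩
    by_cases h0 : g (Fin.last d) = 0
    · exact ⟨1, 0, Submodule.zero_mem _, by simp [h0]⟩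
    · have hgi : g i ∈ Ideal.span (Set.range g) := Ideal.subset_span ⟨i, rfl⟩
      refine ⟨1, g i, by rwa [pow_one], ?_⟩
      rw [pow_one, div_mul_cancel₀]
      exact fun h => h0 ((IsFractionRing.injective R (FractionRing R)) (by rw [h, map_zero]))
  · intro r
    exact ⟨0, r, by simp, by simp⟩
  · rintro a b - - ⟨n, r, hr, ha⟩ ⟨m, s, hs, hb⟩
    have hgl : g (Fin.last d) ∈ Ideal.span (Set.range g) := Ideal.subset_span ⟨_, rfl⟩
    refine ⟨n + m, r * g (Fin.last d) ^ m + s * g (Fin.last d) ^ n, ?_, ?_⟩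
    · refine add_mem ?_ ?_
      · rw [pow_add]
        exact Ideal.mul_mem_mul hr (Ideal.pow_mem_pow hgl m)
      · rw [add_comm n m, pow_add]
        exact Ideal.mul_mem_mul hs (Ideal.pow_mem_pow hgl n)
    · rw [map_add, map_mul, map_mul, map_pow, map_pow, ← ha, ← hb]
      ring
  · rintro a b - - ⟨n, r, hr, ha⟩ ⟨m, s, hs, hb⟩
    refine ⟨n + m, r * s, ?_, ?_⟩
    · rw [pow_add]; exact Ideal.mul_mem_mul hr hs
    · rw [map_mul, ← ha, ← hb]; ring

/-- **Frobenius-closedness descends from the blow-up chart to the centre.** Let `R` be a domain,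
`g₀, …, g_d ∈ R` with `g_d` a non-zerodivisor modulo `(g₀, …, g_{d-1})`, `𝔞 = (g)`, and
`A = R[gᵢ/g_d] ⊆ Frac R` the `D₊(g_d)`-chart of `Bl_𝔞 Spec R`. If for every maximal ideal `M` of `A` the
principal ideal `g_d A_M` is Frobenius closed (inline form, exponent base `p`), then `𝔞` is Frobenius
closed in `R` (inline form). [folklore] -/
theorem frobeniusClosed_of_blowupChart (p : ℕ)
    (hlast : ∀ u : R, g (Fin.last d) * u ∈ Ideal.span (Set.range fun i : Fin d => g i.castSucc) →
      u ∈ Ideal.span (Set.range fun i : Fin d => g i.castSucc))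
    (hA : ∀ (M : Ideal (Algebra.adjoin R (Set.range fun i : Fin (d + 1) => algebraMap R (FractionRing R) (g i) / algebraMap R (FractionRing R) (g (Fin.last d))))) [M.IsMaximal] (w : Localization.AtPrime M),
      (∃ e : ℕ, w ^ p ^ e ∈ Ideal.span ((fun z : Localization.AtPrime M => z ^ p ^ e) ''
        (Ideal.span {algebraMap (Algebra.adjoin R (Set.range fun i : Fin (d + 1) => algebraMap R (FractionRing R) (g i) / algebraMap R (FractionRing R) (g (Fin.last d)))) (Localization.AtPrime M)
          (algebraMap R (Algebra.adjoin R (Set.range fun i : Fin (d + 1) => algebraMap R (FractionRing R) (g i) / algebraMap R (FractionRing R) (g (Fin.last d)))) (g (Fin.last d)))} : Set (Localization.AtPrime M)))) →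
      w ∈ Ideal.span {algebraMap (Algebra.adjoin R (Set.range fun i : Fin (d + 1) => algebraMap R (FractionRing R) (g i) / algebraMap R (FractionRing R) (g (Fin.last d)))) (Localization.AtPrime M) (algebraMap R (Algebra.adjoin R (Set.range fun i : Fin (d + 1) => algebraMap R (FractionRing R) (g i) / algebraMap R (FractionRing R) (g (Fin.last d)))) (g (Fin.last d)))})
    (y : R) (hy : ∃ e : ℕ, y ^ p ^ e ∈ Ideal.span ((fun z : R => z ^ p ^ e) ''
      (Ideal.span (Set.range g) : Set R))) :
    y ∈ Ideal.span (Set.range g) := by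
  classical
  obtain ⟨e, he⟩ := hy
  set 𝔟 : Ideal R := Ideal.span (Set.range fun i : Fin d => g i.castSucc) with h𝔟
  have h𝔞 : Ideal.span (Set.range g) = 𝔟 ⊔ Ideal.span {g (Fin.last d)} :=
    span_range_eq_sup_span_last g
  by_cases hgl0 : g (Fin.last d) = 0
  · -- degenerate: `g_d = 0` regular modulo `𝔟` forces `𝔟 = R`
    have h1 : (1 : R) ∈ 𝔟 := hlast 1 (by rw [hgl0, zero_mul]; exact zero_mem _)
    rw [h𝔞, Ideal.eq_top_of_isUnit_mem _ h1 isUnit_one, top_sup_eq]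
    trivial
  have hglK : (algebraMap R (FractionRing R)) (g (Fin.last d)) ≠ 0 := fun h =>
    hgl0 (IsFractionRing.injective R (FractionRing R) (by rw [h, map_zero]))
  set ay : (Algebra.adjoin R (Set.range fun i : Fin (d + 1) => algebraMap R (FractionRing R) (g i) / algebraMap R (FractionRing R) (g (Fin.last d)))) := algebraMap R (Algebra.adjoin R (Set.range fun i : Fin (d + 1) => algebraMap R (FractionRing R) (g i) / algebraMap R (FractionRing R) (g (Fin.last d)))) y with hay
  set ag : (Algebra.adjoin R (Set.range fun i : Fin (d + 1) => algebraMap R (FractionRing R) (g i) / algebraMap R (FractionRing R) (g (Fin.last d)))) := algebraMap R (Algebra.adjoin R (Set.range fun i : Fin (d + 1) => algebraMap R (FractionRing R) (g i) / algebraMap R (FractionRing R) (g (Fin.last d)))) (g (Fin.last d)) with hag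
  -- Step 1: `ay ^ q ∈ (ag ^ q)` in `A`, because `z = (z / g_d) · g_d` with `z / g_d ∈ A` for `z ∈ (g)`
  have h1 : ay ^ p ^ e ∈ Ideal.span {ag ^ p ^ e} := by
    have hmap := Ideal.mem_map_of_mem (algebraMap R (Algebra.adjoin R (Set.range fun i : Fin (d + 1) => algebraMap R (FractionRing R) (g i) / algebraMap R (FractionRing R) (g (Fin.last d))))) he
    rw [map_pow, Ideal.map_span] at hmap
    refine (Ideal.span_le.mpr ?_ : Ideal.span _ ≤ Ideal.span {ag ^ p ^ e}) hmap
    rintro _ ⟨_, ⟨z, hz, rfl⟩, rfl⟩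
    have hb : (algebraMap R (FractionRing R)) z / (algebraMap R (FractionRing R)) (g (Fin.last d)) ∈ (Algebra.adjoin R (Set.range fun i : Fin (d + 1) => algebraMap R (FractionRing R) (g i) / algebraMap R (FractionRing R) (g (Fin.last d)))) := div_last_mem_adjoin g hz
    have hz' : algebraMap R (Algebra.adjoin R (Set.range fun i : Fin (d + 1) => algebraMap R (FractionRing R) (g i) / algebraMap R (FractionRing R) (g (Fin.last d)))) z = (⟨_, hb⟩ : (Algebra.adjoin R (Set.range fun i : Fin (d + 1) => algebraMap R (FractionRing R) (g i) / algebraMap R (FractionRing R) (g (Fin.last d))))) * ag := by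
      apply Subtype.ext
      rw [Subalgebra.coe_algebraMap, Subalgebra.coe_mul, hag, Subalgebra.coe_algebraMap,
        div_mul_cancel₀ _ hglK]
    rw [SetLike.mem_coe, map_pow, hz', mul_pow]
    exact Ideal.mul_mem_left _ _ (Ideal.mem_span_singleton_self _)
  -- Step 2: `ay ∈ (ag)` by the local-global principle and Frobenius-closedness of `(ag)` at every `A_M`
  have h2 : ay ∈ Ideal.span {ag} := by
    refine Ideal.mem_of_localization_maximal fun M hM => ?_
    haveI := hM
    rw [Ideal.map_span, Set.image_singleton]
    refine hA M (algebraMap (Algebra.adjoin R (Set.range fun i : Fin (d + 1) => algebraMap R (FractionRing R) (g i) / algebraMap R (FractionRing R) (g (Fin.last d)))) (Localization.AtPrime M) ay) ⟨e, ?_⟩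
    have h1' := Ideal.mem_map_of_mem (algebraMap (Algebra.adjoin R (Set.range fun i : Fin (d + 1) => algebraMap R (FractionRing R) (g i) / algebraMap R (FractionRing R) (g (Fin.last d)))) (Localization.AtPrime M)) h1
    rw [map_pow, Ideal.map_span, Set.image_singleton, map_pow] at h1'
    refine (Ideal.span_le.mpr ?_ : Ideal.span _ ≤ _) h1'
    rintro _ rfl
    exact Ideal.subset_span ⟨_, Ideal.mem_span_singleton_self _, rfl⟩
  -- Step 3: back in `R`: `y · g_dⁿ = r · g_d` with `r ∈ (g)ⁿ`
  obtain ⟨c, hc⟩ := Ideal.mem_span_singleton'.mp h2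
  obtain ⟨n, r, hr, hcr⟩ := exists_mul_pow_eq_of_mem_adjoin g c.2
  have hcK : (c : (FractionRing R)) * (algebraMap R (FractionRing R)) (g (Fin.last d)) = (algebraMap R (FractionRing R)) y := by
    have h := congrArg Subtype.val hc
    rwa [Subalgebra.coe_mul, hag, hay, Subalgebra.coe_algebraMap, Subalgebra.coe_algebraMap] at h
  have hK : (algebraMap R (FractionRing R)) (y * g (Fin.last d) ^ n) = (algebraMap R (FractionRing R)) (r * g (Fin.last d)) := by
    rw [map_mul, map_pow, ← hcK, map_mul, ← hcr]
    ring
  have hR : y * g (Fin.last d) ^ n = r * g (Fin.last d) := IsFractionRing.injective R (FractionRing R) hK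
  -- Step 4: `y ∈ (g)` since `g_d` is regular modulo `𝔟`
  rw [h𝔞]
  rcases n with _ | k
  · rw [pow_zero, mul_one] at hR
    rw [hR]
    exact Ideal.mem_sup_right (Ideal.mem_span_singleton'.mpr ⟨r, rfl⟩)
  · refine mem_of_mul_pow_mem_pow hlast k y ?_
    rw [← h𝔞]
    have hyk : y * g (Fin.last d) ^ k = r := by
      have h' : g (Fin.last d) * (y * g (Fin.last d) ^ k) = g (Fin.last d) * r := by
        rw [← mul_comm r, ← hR]; ring
      exact mul_left_cancel₀ hgl0 h'
    rw [hyk]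
    exact hr

end Chart

/-! ## §3 The no-go in the crux's vocabulary -/

section NoGo

variable (p : ℕ) [Fact p.Prime] {R : Type} [CommRing R] [IsDomain R] [IsNoetherianRing R] [CharP R p]
  {d : ℕ} (g : Fin (d + 1) → R)


/-- **NO-GO FOR PARAMETER-IDEAL CENTRES (last element regular modulo the others).** Let `R` be a
Noetherian domain of prime characteristic `p`, `g₀, …, g_d ∈ R` with `g_d` a non-zerodivisor modulo
`(g₀, …, g_{d-1})`, and suppose the ideal `𝔞 = (g)` is NOT Frobenius closed (some `y ∉ 𝔞` has
`y^(p^e) ∈ 𝔞^[p^e]`). Then the chart algebra `A = R[gᵢ/g_d] ⊆ Frac R` of the blow-up of `Spec R`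
along `𝔞` has a maximal ideal `M` whose local ring `A_M` — the stalk of `Bl_𝔞 Spec R` at a closed
point of the chart `D₊(g_d)` — violates the per-stalk clause of crux `FInjectiveMacaulayfication`
(domain ∧ every system of parameters weakly regular ∧ every parameter ideal Frobenius closed, stated
here for the ring `A_M` verbatim). Proof: otherwise every `A_M` is a Noetherian local domain of
characteristic `p` satisfying the clause, so all its principal ideals are Frobenius closed
(`Literature…span_singleton_frobeniusClosed_of_fInjective_clause`), and `frobeniusClosed_of_blowupChart`
makes `𝔞` Frobenius closed. [folklore] -/
theorem exists_not_fInjectiveClause_of_blowupChart_of_regular_last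
    (hlast : ∀ u : R, g (Fin.last d) * u ∈ Ideal.span (Set.range fun i : Fin d => g i.castSucc) →
      u ∈ Ideal.span (Set.range fun i : Fin d => g i.castSucc))
    (hnot : ∃ y : R, (∃ e : ℕ, y ^ p ^ e ∈ Ideal.span ((fun z : R => z ^ p ^ e) ''
      (Ideal.span (Set.range g) : Set R))) ∧ y ∉ Ideal.span (Set.range g)) :
    ∃ (M : Ideal (Algebra.adjoin R (Set.range fun i : Fin (d + 1) => algebraMap R (FractionRing R) (g i) / algebraMap R (FractionRing R) (g (Fin.last d))))) (_ : M.IsMaximal),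
      ¬ (IsDomain (Localization.AtPrime M) ∧
          ∀ n : ℕ, ringKrullDim (Localization.AtPrime M) = n →
            ∀ s : Fin n → Localization.AtPrime M, (Ideal.span (Set.range s)).radical.IsMaximal →
              RingTheory.Sequence.IsWeaklyRegular (Localization.AtPrime M) (List.ofFn s) ∧
              ∀ w : Localization.AtPrime M, (∃ e : ℕ, w ^ p ^ e ∈
                Ideal.span ((fun z : Localization.AtPrime M => z ^ p ^ e) ''
                  (Ideal.span (Set.range s) : Set (Localization.AtPrime M)))) →
                w ∈ Ideal.span (Set.range s)) := by
  by_contra hall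
  push Not at hall
  obtain ⟨y, hy, hyn⟩ := hnot
  apply hyn
  refine frobeniusClosed_of_blowupChart g p hlast (fun M hM w hw => ?_) y hy
  obtain ⟨hdom, hcl⟩ := hall M hM
  haveI := hdom
  haveI : IsNoetherianRing (Algebra.adjoin R (Set.range fun i : Fin (d + 1) => algebraMap R (FractionRing R) (g i) / algebraMap R (FractionRing R) (g (Fin.last d)))) :=
    isNoetherianRing_of_fg (Subalgebra.fg_def.mpr ⟨_, Set.finite_range _, rfl⟩)
  haveI : IsNoetherianRing (Localization.AtPrime M) :=
    IsLocalization.isNoetherianRing M.primeCompl _ inferInstance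
  haveI : CharP (Localization.AtPrime M) p :=
    CharP.of_ringHom_of_ne_zero
      ((algebraMap (Algebra.adjoin R (Set.range fun i : Fin (d + 1) => algebraMap R (FractionRing R) (g i) / algebraMap R (FractionRing R) (g (Fin.last d)))) (Localization.AtPrime M)).comp (algebraMap R (Algebra.adjoin R (Set.range fun i : Fin (d + 1) => algebraMap R (FractionRing R) (g i) / algebraMap R (FractionRing R) (g (Fin.last d)))))) p (Fact.out : p.Prime).ne_zero
  exact Literature.RingTheory.TightClosure.span_singleton_frobeniusClosed_of_fInjective_clause p hcl _
    w hw

/-- **NO-GO FOR PARAMETER-IDEAL CENTRES (weakly regular sequence).** Same as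
`exists_not_fInjectiveClause_of_blowupChart_of_regular_last`, with the regularity hypothesis in the
form carried by the Cohen–Macaulay hypothesis of `stub_fInjectivize` / the depth half of the crux's
clause: `g₀, …, g_d` is a weakly regular sequence (e.g. a system of parameters of a Cohen–Macaulay local
domain, or of a local ring satisfying the crux's clause). **Reading:** at a Cohen–Macaulay point that is
not F-injective some ideal generated by a system of parameters is not Frobenius closed (Fedder 1983), and
blowing it up — Kawasaki's Macaulayfication move, or the route header's foreseen `IsolatedFInjBlowup` —
produces a scheme that again violates the crux's clause at a closed point of the `g_d`-chart, for every
prime `p`: the centres of an F-injectivisation engine can never be the offending parameter ideals.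
Generalises the chart witnesses `stub_parameter_blowup_not_frobenius_closed` (`E₈⁰`, centre `(x,y)`) and
`Negative.fInjectiveMacaulayfication_parameterBlowupChart_not_frobeniusClosed`. [folklore] -/
theorem exists_not_fInjectiveClause_of_blowupChart
    (hreg : RingTheory.Sequence.IsWeaklyRegular R (List.ofFn g))
    (hnot : ∃ y : R, (∃ e : ℕ, y ^ p ^ e ∈ Ideal.span ((fun z : R => z ^ p ^ e) ''
      (Ideal.span (Set.range g) : Set R))) ∧ y ∉ Ideal.span (Set.range g)) :
    ∃ (M : Ideal (Algebra.adjoin R (Set.range fun i : Fin (d + 1) => algebraMap R (FractionRing R) (g i) / algebraMap R (FractionRing R) (g (Fin.last d))))) (_ : M.IsMaximal),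
      ¬ (IsDomain (Localization.AtPrime M) ∧
          ∀ n : ℕ, ringKrullDim (Localization.AtPrime M) = n →
            ∀ s : Fin n → Localization.AtPrime M, (Ideal.span (Set.range s)).radical.IsMaximal →
              RingTheory.Sequence.IsWeaklyRegular (Localization.AtPrime M) (List.ofFn s) ∧
              ∀ w : Localization.AtPrime M, (∃ e : ℕ, w ^ p ^ e ∈
                Ideal.span ((fun z : Localization.AtPrime M => z ^ p ^ e) ''
                  (Ideal.span (Set.range s) : Set (Localization.AtPrime M)))) →
                w ∈ Ideal.span (Set.range s)) :=
  exists_not_fInjectiveClause_of_blowupChart_of_regular_last p g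
    (mem_of_last_mul_mem_of_isWeaklyRegular g hreg) hnot

end NoGo

/-! ## §4 Registration-friendly restatement (all binders explicit, no notation) -/

/-- **Parameter-ideal centres are inadmissible for F-injectivisation** — the no-go
`exists_not_fInjectiveClause_of_blowupChart` with every binder explicit and the chart algebra written
out (`Algebra.adjoin R {g i / g_d} ⊆ Frac R`): for every prime `p`, Noetherian domain `R` of
characteristic `p` and weakly regular `g₀, …, g_d` generating an ideal that is not Frobenius closed, some
closed point of the `g_d`-chart of the blow-up along `(g)` has a local ring violating the per-stalk
clause of crux `FInjectiveMacaulayfication`. [folklore] -/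
theorem parameterCentre_noGo : ∀ (p : ℕ) [Fact p.Prime] (R : Type) [CommRing R] [IsDomain R] [IsNoetherianRing R] [CharP R p] (d : ℕ) (g : Fin (d + 1) → R), RingTheory.Sequence.IsWeaklyRegular R (List.ofFn g) → (∃ y : R, (∃ e : ℕ, y ^ p ^ e ∈ Ideal.span ((fun z : R => z ^ p ^ e) '' (Ideal.span (Set.range g) : Set R))) ∧ y ∉ Ideal.span (Set.range g)) → ∃ (M : Ideal (Algebra.adjoin R (Set.range fun i : Fin (d + 1) => algebraMap R (FractionRing R) (g i) / algebraMap R (FractionRing R) (g (Fin.last d))))) (_ : M.IsMaximal), ¬ (IsDomain (Localization.AtPrime M) ∧ ∀ n : ℕ, ringKrullDim (Localization.AtPrime M) = n → ∀ s : Fin n → Localization.AtPrime M, (Ideal.span (Set.range s)).radical.IsMaximal → RingTheory.Sequence.IsWeaklyRegular (Localization.AtPrime M) (List.ofFn s) ∧ ∀ w : Localization.AtPrime M, (∃ e : ℕ, w ^ p ^ e ∈ Ideal.span ((fun z : Localization.AtPrime M => z ^ p ^ e) '' (Ideal.span (Set.range s) : Set (Localization.AtPrime M)))) → w ∈ Ideal.span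 (Set.range s)) :=
  fun p _ _ _ _ _ _ _ g hreg hnot => exists_not_fInjectiveClause_of_blowupChart p g hreg hnot

end Summit.ResolutionOfSingularities.ResolutionOfSingularities.Theorems.FInjectiveMacaulayfication

end
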